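import Summits.QuantumFields.YangMills.Theorems.UnitScaleTiltProp7AxialReprPrint
import HarnessLib

/-!
# Route `UnitScaleTilt`, crux K1 child «MinimiserStabilityRegPr» (stmt-QuantumFields-19200), registered stub `stub_prop7From14` (skeleton birth_v7
# cc37a178…; leaf V3) — NON-VACUITY OF PRINT'S BASED SECT. A LETTERS: the trivial gauge transformation satisfies (1.29) relative to EVERY background,
# and every background lies on its own (1.19)-surface (for the refuter vet of the v8 re-cut: the letters `S_print` of CARD-19200-V3-g8 §1(e) are
# satisfiable at the obvious points)

Cell `ym3-torus` ∕ fleet seat `ym-ust-19200-p1` (gen 8; HUMAN RULING D-0037, YM ladder rung R3).  WHY.  The v8 re-cut of V3 is penned over a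
presentation `S_print` whose two Sect. A fields are [Balaban1985RegularSpaces] (1.19) ∕ (1.29) read on the `ℤᵈ` pullbacks based at the `k`-centre
`x₀ = embIter k 0` (`Prop7AxialReprPrint`, `Prop7ChartPrint`, `Prop7PillarsPrint`).  Refuters first test a presented field for vacuity; this file records
the two obvious inhabitants: (1.29) holds for `u = 1` ([Balaban1985Averaging] (78)–(80): the averages of the constant `1` are `1`, `B7Eq78Linearization.Rbar_one`)
and (1.19) holds for `U = U₀` ([Balaban1985RegularSpaces] p. 78 «the surfaces pass through the element U₀», `B8Eq119TwistedAxial.inAx_self`).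

WHAT IS PROVED (sorry-free, no definition): `restr129_based_one` (any base point, any background), `inAx_based_self` (any base point), and the T³
readings `restricted_print_one`, `isAxial_print_self` for every presentation `S` whose fields are implied by the based readings.

HONEST SCOPE.  Elementary bookkeeping; count-neutral helper toward stmt-QuantumFields-19200 (`--supports`), not a proof of the stub.

References: T. Bałaban, CMP 99 (1985) 75–102 [Balaban1985RegularSpaces] (p.78, (1.19) p.79, (1.29) p.81); CMP 98 (1985) 17–51 [Balaban1985Averaging]
((78)–(80) p.30).
-/

noncomputable section

namespace Summit.QuantumFields.YangMills.Theorems.Prop7PrintLettersSanity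

open Literature.MathematicalPhysics.QuantumFieldTheory.Balaban1983to89
open B7Prop1Explicit renaming Site → LSite
open B7Eq78Linearization (Rbar Rbar_one zdBlocking)
open B8Eq119TwistedAxial (InAx Restr129 inAx_self bgT)
open B8Thm4TorusAt (torusLam)
open B15DeterminingSets (embIter)
open B10Eq27TorusAxialLog (pull unitsField toUField)
open B8Thm2SetupTorus (pullGauge pullGauge_apply toUGauge)

/-! ## §1 At the Setup torus, any base point -/

section Torus

open scoped Matrix.Norms.L2Operator

variable {P : Params} {N : ℕ}

/-- **(1.29) HOLDS FOR THE TRIVIAL GAUGE TRANSFORMATION** relative to every background, every base point, every family of constraint sets: the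
`j`-th order averages (79)–(80) of `u ≡ 1` are `1` (`B7Eq78Linearization.Rbar_one`). [cite: Balaban1985RegularSpaces, (1.29) p.81; Balaban1985Averaging, (78)–(80) p.30] -/
theorem restr129_based_one (k : ℕ) (Λ : ℕ → Set (LSite P.d)) (U₀ : GaugeField P 0 (Matrix.specialUnitaryGroup (Fin N) ℂ)) (x₀ : Site P 0) :
    Restr129 P.L k Λ (pull (unitsField (toUField U₀)) x₀)
      (pullGauge (fun x => Unitary.toUnits (toUGauge P N (fun _ => (1 : Matrix.specialUnitaryGroup (Fin N) ℂ)) x)) x₀) := by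
  intro j _ y _
  have h1 : (fun x => ((pullGauge (fun x => Unitary.toUnits (toUGauge P N (fun _ => (1 : Matrix.specialUnitaryGroup (Fin N) ℂ)) x)) x₀ x :
      (Matrix (Fin N) (Fin N) ℂ)ˣ) : Matrix (Fin N) (Fin N) ℂ)) = fun _ => 1 := by
    funext x
    simp only [pullGauge_apply, B8Thm2SetupTorus.toUGauge_apply, map_one, Units.val_one]
  rw [h1, Rbar_one]

/-- **EVERY BACKGROUND LIES ON ITS OWN (1.19)-SURFACE** in the based reading (p. 78 «the surfaces pass through the element U₀»;
`B8Eq119TwistedAxial.inAx_self`). [cite: Balaban1985RegularSpaces, p.78, (1.19) p.79] -/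
theorem inAx_based_self (k : ℕ) (Λ : ℕ → Set (LSite P.d)) (U₀ : GaugeField P 0 (Matrix.specialUnitaryGroup (Fin N) ℂ)) (x₀ : Site P 0) :
    InAx P.L k Λ (pull (unitsField (toUField U₀)) x₀) (pull (unitsField (toUField U₀)) x₀) :=
  inAx_self _ _ _ _

end Torus

/-! ## §2 At the T³ carrier, for every presentation with print's based letters -/

section T3

open scoped Matrix.Norms.L2Operator
open Literature.MathematicalPhysics.QuantumFieldTheory.Balaban1983to89.T3ContinuumYM3Torus
open T3SectALandauChart (Resid)

variable (F : T3Family) {n K : ℕ}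

/-- **`S.Restricted U₀ 1` FOR EVERY BACKGROUND** whenever `S.Restricted` is implied by the based (1.29)-reading: the presented field `Restricted` of
the v8 presentation is inhabited (non-vacuity for the refuter vet). [cite: Balaban1985RegularSpaces, (1.29) p.81] -/
theorem restricted_print_one (S : Resid F n K)
    (hSre : ∀ (U₀ : GaugeField (F.P K) 0 (Matrix.specialUnitaryGroup (Fin 2) ℂ)) (u : GaugeTransf (F.P K) 0 (Matrix.specialUnitaryGroup (Fin 2) ℂ)),
      Restr129 (F.P K).L (K - n) (torusLam (K - n)) (pull (unitsField (toUField U₀)) (embIter (K - n) (0 : Site (F.P K) (K - n))))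
        (pullGauge (fun x => Unitary.toUnits (toUGauge (F.P K) 2 u x)) (embIter (K - n) (0 : Site (F.P K) (K - n)))) → S.Restricted U₀ u)
    (U₀ : GaugeField (F.P K) 0 (Matrix.specialUnitaryGroup (Fin 2) ℂ)) :
    S.Restricted U₀ (fun _ => 1) :=
  hSre U₀ _ (restr129_based_one (K - n) _ U₀ _)

/-- **`S.IsAxial U₀ U₀` FOR EVERY BACKGROUND** whenever `S.IsAxial` is implied by the based (1.19)-reading. [cite: Balaban1985RegularSpaces, p.78, (1.19) p.79] -/
theorem isAxial_print_self (S : Resid F n K)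
    (hSax : ∀ U₀ U : GaugeField (F.P K) 0 (Matrix.specialUnitaryGroup (Fin 2) ℂ),
      InAx (F.P K).L (K - n) (torusLam (K - n)) (pull (unitsField (toUField U₀)) (embIter (K - n) (0 : Site (F.P K) (K - n))))
        (pull (unitsField (toUField U)) (embIter (K - n) (0 : Site (F.P K) (K - n)))) → S.IsAxial U₀ U)
    (U₀ : GaugeField (F.P K) 0 (Matrix.specialUnitaryGroup (Fin 2) ℂ)) :
    S.IsAxial U₀ U₀ :=
  hSax U₀ U₀ (inAx_based_self (K - n) _ U₀ _)

end T3

end Summit.QuantumFields.YangMills.Theorems.Prop7PrintLettersSanity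

end
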